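import Mathlib.Analysis.SpecificLimits.Basic
import HarnessLib

/-!
# Far-edge descent, kernel XXXIX-I — squaring towers are extinct for EVERY `β < 2` (model level)

Kernel XXXIX-H used the node floor of XXXIX-G at `p + 1 = a²` and the minimum-width mass fraction to
kill squaring towers of the β-dial below `β = 2 − 1/a²`.  The same floor at `p + 1 = a^j`,
`r ≥ Q + (2 − a^{−j})·L_{≥j}` (`L_{≥j}` = mass on legs of width divisible by `a^j`), together with the
bookkeeping of ALL width classes under squaring, kills them for every `β < 2` — and `β = 2`
(Schönhage's `E₃` tower, the CW bookkeeping: kernel XXXV) is exactly the boundary.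

Bookkeeping (prose, the hypothesis `hrec` below).  In a squaring tower grown from width-`a` bases every
leg width is a power `a^e`, `e ≥ 1`; write `M_k(e)` for the leg mass at width `a^e` at level `k` and
`F_j(k) = M_k(e < j)/L_k` for the fraction below `a^j` (`F_1 ≡ 0`).  The product step with
re-anchoring (kernel XXXVIII) gives `M_{k+1}(e) = 2Q_k M_k(e) + ∑_{e'+e''=e} M_k(e')M_k(e'')` and
`L_{k+1} = 2Q_kL_k + L_k²`; since `e' + e'' < j` with `e', e'' ≥ 1` forces `e' < j − 1` and `e'' < j`,
`M_{k+1}(e < j) ≤ 2Q_k M_k(e<j) + M_k(e<j−1)·M_k(e<j)`, i.e.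
`F_j(k+1) ≤ F_j(k)·(2ρ_k + F_{j−1}(k))/(2ρ_k + 1) ≤ F_j(k)·(2ρ + F_{j−1}(k))/(2ρ + 1)`
for an anchor ratio `ρ_k = Q_k/L_k ≤ ρ` (bounded along squaring towers, whose share tends to the fixed
point `1/(2β−1)`; the last step uses `F_{j−1} ≤ 1`).

* **`fractions_vanish`** — from `F_1 ≡ 0`, `0 ≤ F ≤ 1` and `hrec`: every `F_j(k) → 0` as `k → ∞`
  (induction on `j`: once `F_{j−1} ≤ 1/2` the factor is `≤ (2ρ + 1/2)/(2ρ + 1) < 1`);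
* **`squaring_tower_extinct_all`** — for every `β < 2` and `a > 1` some node `k` and depth `j` have
  `β·L_k < (2 − a^{−j})·(1 − F_j(k))·L_k`: the claimed budget `Q_k + βL_k` is below the wide
  Landsberg–Ottaviani floor of kernel XXXIX-G for the object the node claims to certify.

HONEST FRAMING: a statement about the MODEL's bookkeeping (real sequences), with the tensor input
(XXXIX-G's floor) appearing only as the shape of the conclusion; linear towers (a fresh base at every
step) replenish narrow legs and are NOT excluded; nothing about `ω(1,k,1)` or `AnchoredLogConvexity`.
No definitions.

References: kernels XXXVIII (`dial_product_step`), XXXIX-G (`lo_floor_wide`), XXXIX-H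
(`squaring_tower_extinct`); Landsberg–Ottaviani 2015, Thm. 1.1 [LandsbergOttaviani2015].
-/

noncomputable section

set_option linter.dupNamespace false

namespace Summit.MatrixMultiplication.MatrixMultiplication.Theorems.FarEdgeDescentDialExtinctionDeep

/-- Geometric decay from a threshold: if `x_{k+1} ≤ θ·x_k` for `k ≥ K`, `x ≤ 1`, `0 ≤ θ`, then
`x_{K+n} ≤ θ^n`. -/
theorem decay_from {θ : ℝ} (hθ : 0 ≤ θ) (x : ℕ → ℝ) (h1 : ∀ k, x k ≤ 1) (K : ℕ)
    (hstep : ∀ k, K ≤ k → x (k + 1) ≤ θ * x k) (n : ℕ) : x (K + n) ≤ θ ^ n := by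
  induction n with
  | zero => simpa using h1 K
  | succ n ih =>
    calc x (K + (n + 1)) = x (K + n + 1) := by rw [Nat.add_assoc]
      _ ≤ θ * x (K + n) := hstep _ (Nat.le_add_right K n)
      _ ≤ θ * θ ^ n := mul_le_mul_of_nonneg_left ih hθ
      _ = θ ^ (n + 1) := by ring

/-- **All width-class fractions vanish along a squaring tower.**  With `F_1 ≡ 0`, `0 ≤ F ≤ 1` and the
squaring bookkeeping `F_{j+2}(k+1) ≤ F_{j+2}(k)·(2ρ + F_{j+1}(k))/(2ρ+1)` (`ρ > 0` a bound for the
anchor ratio), every `F_j(k)`, `j ≥ 1`, tends to `0`: `∀ ε > 0, ∃ K, ∀ k ≥ K, F_j(k) < ε`. -/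
theorem fractions_vanish {ρ : ℝ} (hρ : 0 < ρ) (F : ℕ → ℕ → ℝ) (h0 : ∀ j k, 0 ≤ F j k)
    (h1 : ∀ j k, F j k ≤ 1) (hF1 : ∀ k, F 1 k = 0)
    (hrec : ∀ j k, F (j + 2) (k + 1) ≤ F (j + 2) k * (2 * ρ + F (j + 1) k) / (2 * ρ + 1)) :
    ∀ j, 1 ≤ j → ∀ ε, 0 < ε → ∃ K, ∀ k, K ≤ k → F j k < ε := by
  intro j hj
  induction j with
  | zero => omega
  | succ j ih =>
    rcases Nat.eq_zero_or_pos j with hj0 | hjpos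
    · subst hj0
      intro ε hε
      exact ⟨0, fun k _ => by rw [hF1 k]; exact hε⟩
    · intro ε hε
      -- threshold where `F_j ≤ 1/2`
      obtain ⟨K₁, hK₁⟩ := ih hjpos (1 / 2) one_half_pos
      set θ : ℝ := (2 * ρ + 1 / 2) / (2 * ρ + 1) with hθ
      have hθ0 : 0 ≤ θ := div_nonneg (by linarith) (by linarith)
      have hθ1 : θ < 1 := (div_lt_one (by linarith)).2 (by linarith)
      obtain ⟨j', rfl⟩ : ∃ j', j = j' + 1 := ⟨j - 1, by omega⟩
      have hstep : ∀ k, K₁ ≤ k → F (j' + 1 + 1) (k + 1) ≤ θ * F (j' + 1 + 1) k := by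
        intro k hk
        have hr := hrec j' k
        have hFj := hK₁ k hk
        have hnum : F (j' + 2) k * (2 * ρ + F (j' + 1) k) ≤ F (j' + 2) k * (2 * ρ + 1 / 2) :=
          mul_le_mul_of_nonneg_left (by linarith) (h0 _ _)
        have h21 : (0 : ℝ) < 2 * ρ + 1 := by linarith
        calc F (j' + 1 + 1) (k + 1) = F (j' + 2) (k + 1) := rfl
          _ ≤ F (j' + 2) k * (2 * ρ + F (j' + 1) k) / (2 * ρ + 1) := hr
          _ ≤ F (j' + 2) k * (2 * ρ + 1 / 2) / (2 * ρ + 1) := div_le_div_of_nonneg_right hnum h21.le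
          _ = θ * F (j' + 1 + 1) k := by rw [hθ]; ring
      obtain ⟨n, hn⟩ := exists_pow_lt_of_lt_one hε hθ1
      refine ⟨K₁ + n, fun k hk => ?_⟩
      obtain ⟨d, rfl⟩ : ∃ d, k = K₁ + (n + d) := ⟨k - K₁ - n, by omega⟩
      have hdec := decay_from hθ0 (F (j' + 1 + 1)) (h1 _) K₁ hstep (n + d)
      have hpow : θ ^ (n + d) ≤ θ ^ n := pow_le_pow_of_le_one hθ0 hθ1.le (Nat.le_add_right n d)
      exact lt_of_le_of_lt (hdec.trans hpow) hn

/-- **Squaring towers are extinct for every `β < 2`.**  For `a > 1`, `β < 2`, fractions `F_j(k)` as in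
`fractions_vanish` and positive leg masses `L_k`, some node `k` and depth `j` satisfy
`β·L_k < (2 − 1/a^j)·(1 − F_j(k))·L_k` — the node's claimed budget `Q_k + β·L_k` is below the wide
Landsberg–Ottaviani floor `Q_k + (2 − a^{−j})·L_{≥j}` (kernel XXXIX-G at `p + 1 = a^j`).
[cite: LandsbergOttaviani2015, Thm 1.1] -/
theorem squaring_tower_extinct_all {β a ρ : ℝ} (ha : 1 < a) (hβ : β < 2) (hρ : 0 < ρ)
    (F : ℕ → ℕ → ℝ) (h0 : ∀ j k, 0 ≤ F j k) (h1 : ∀ j k, F j k ≤ 1) (hF1 : ∀ k, F 1 k = 0)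
    (hrec : ∀ j k, F (j + 2) (k + 1) ≤ F (j + 2) k * (2 * ρ + F (j + 1) k) / (2 * ρ + 1))
    (L : ℕ → ℝ) (hL : ∀ k, 0 < L k) :
    ∃ j k, β * L k < (2 - 1 / a ^ j) * ((1 - F j k) * L k) := by
  have ha0 : 0 < a := by linarith
  have hia0 : 0 ≤ 1 / a := by positivity
  have hia1 : 1 / a < 1 := (div_lt_one ha0).2 ha
  obtain ⟨j, hj⟩ := exists_pow_lt_of_lt_one (show 0 < 2 - β by linarith) hia1
  -- use depth `j + 1 ≥ 1`
  have hj1 : (1 / a) ^ (j + 1) < 2 - β :=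
    lt_of_le_of_lt (pow_le_pow_of_le_one hia0 hia1.le (Nat.le_succ j)) hj
  set c : ℝ := 2 - 1 / a ^ (j + 1) with hc
  have hc' : c = 2 - (1 / a) ^ (j + 1) := by rw [hc, one_div_pow]
  have hβc : β < c := by rw [hc']; linarith
  have hcpos : 0 < c := by
    have : (1 / a) ^ (j + 1) ≤ 1 := pow_le_one₀ hia0 hia1.le
    rw [hc']
    linarith
  set ε : ℝ := 1 - β / c with hε
  have hε0 : 0 < ε := by
    have : β / c < 1 := (div_lt_one hcpos).2 hβc
    rw [hε]
    linarith
  obtain ⟨K, hK⟩ := fractions_vanish hρ F h0 h1 hF1 hrec (j + 1) (by omega) ε hε0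
  refine ⟨j + 1, K, ?_⟩
  have hFK : F (j + 1) K < ε := hK K le_rfl
  have hβc' : β < c * (1 - F (j + 1) K) := by
    have h2 : c * F (j + 1) K < c * ε := mul_lt_mul_of_pos_left hFK hcpos
    have h3 : c * ε = c - β := by rw [hε, mul_sub, mul_one, mul_div_cancel₀ _ hcpos.ne']
    rw [h3] at h2
    linarith
  have := mul_lt_mul_of_pos_right hβc' (hL K)
  rw [mul_assoc] at this
  exact this

end Summit.MatrixMultiplication.MatrixMultiplication.Theorems.FarEdgeDescentDialExtinctionDeep

end
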